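import Summits.ValiantsHypothesis.ValiantsHypothesis.Theorems.KPlusLogSqLawMixedGaugeTwoClassRatioThreeHalves
import Summits.ValiantsHypothesis.ValiantsHypothesis.Theorems.KPlusLogSqLawMixedGaugeTwoThirdsLoewnerIntegrals
import Summits.ValiantsHypothesis.ValiantsHypothesis.Theorems.KPlusLogSqLawMixedGaugeCubeLoewnerKernel

/-!
# Route «KPlusLogSqLaw», `WeakLifting` (stmt-ValiantsHypothesis-19561) — the `t^{2/3}` LOEWNER KERNEL is positive definite, and
# THE TWO-CLASS LAW at ratio 3 : 2 becomes unconditional: `ζ ≤ n + 2m` against Descartes ≈ 2n + 3m/… 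

HONEST FRAMING.  Helper file (seat val-sym-lift-p4 g26, cell `pub-symmetroid`, 2026-08-29; `--supports 19561 --as helper`, zero crux
credit), mixed-gauge series.  (1) `twoThirdsLoewner_form_eq_integral`: `I₂ · Σⱼₗ cⱼcₗ (xⱼ + xₗ)/(xⱼ² + xⱼxₗ + xₗ²) = ∫₀^∞ μ⁴ (Σⱼ cⱼ/(xⱼ³+μ³))² dμ`
(`I₂ = ∫₀^∞ s ds/(1+s³) > 0`, from `MixedGauge.integral_pair4`); `twoThirdsLoewner_nonneg`; with the non-vanishing lemma
`MixedGauge.exists_sum_div_ne_zero` (✓ cube-root kernel file) the STRICT positive definiteness `twoThirdsLoewner_posDef` — literally the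
hypothesis `hK` of `MixedGauge.card_posZeros_le_blocks_threeHalves_of_loewner`.  (2) THE TWO-CLASS LAW AT RATIO 3 : 2, UNCONDITIONAL
(`card_posZeros_le_blocks_threeHalves`, `card_posRoots_det_blockPencil_le_threeHalves`): for `A ∈ Sym(n)`, `C ∈ Sym(m)`, any real `B`,
`a ≥ 1`, the determinant of `[[A + X^{2a}·1, B], [Bᵀ, C − X^{3a}·1]]` has at most `n + 2m` distinct positive roots (the monomial bands
`x^{2a·i + 3a·j}` interleave; Descartes' count exceeds `n + 2m` by about `n·m`).  Nothing here is about `WeakLifting` / `TropicalB` in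
their windows, the doors, `MatrixDescartes` (18050) or VP ≠ VNP.  No `def`; axioms standard.  [Löwner–Heinz for the kernel]
-/

set_option linter.dupNamespace false
set_option autoImplicit false

namespace Summit.ValiantsHypothesis.ValiantsHypothesis.Theorems.KPlusLogSqLaw

open MeasureTheory Set Filter Topology Matrix Finset
open scoped BigOperators

namespace MixedGauge

variable {n m : ℕ}

/-! ## 1. The Gram integral of the `t^{2/3}` Loewner form -/

/-- `I₂ · Σⱼₗ cⱼ cₗ (xⱼ + xₗ)/(xⱼ² + xⱼxₗ + xₗ²) = ∫_{(0,∞)} μ⁴ (Σⱼ cⱼ/(xⱼ³ + μ³))² dμ`. -/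
theorem twoThirdsLoewner_form_eq_integral {k : ℕ} (x c : Fin k → ℝ) (hx : ∀ i, 0 < x i) :
    (∫ s in Ioi (0:ℝ), s / (1 + s ^ 3)) * ∑ j, ∑ l, c j * c l * (x j + x l) / (x j ^ 2 + x j * x l + x l ^ 2) =
      ∫ μ in Ioi (0:ℝ), μ ^ 4 * (∑ j, c j / (x j ^ 3 + μ ^ 3)) ^ 2 := by
  have hpt : ∀ μ ∈ Ioi (0:ℝ), μ ^ 4 * (∑ j, c j / (x j ^ 3 + μ ^ 3)) ^ 2 =
      ∑ j, ∑ l, c j * c l * (μ ^ 4 / ((x j ^ 3 + μ ^ 3) * (x l ^ 3 + μ ^ 3))) := by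
    intro μ hμ
    have hμ' : 0 < μ := hμ
    rw [pow_two, Finset.sum_mul_sum, Finset.mul_sum]
    refine Finset.sum_congr rfl fun j _ => ?_
    rw [Finset.mul_sum]
    refine Finset.sum_congr rfl fun l _ => ?_
    have h1 : x j ^ 3 + μ ^ 3 ≠ 0 := by have := hx j; positivity
    have h2 : x l ^ 3 + μ ^ 3 ≠ 0 := by have := hx l; positivity
    field_simp
  rw [setIntegral_congr_fun measurableSet_Ioi hpt]
  have hint : ∀ j l, IntegrableOn (fun μ : ℝ => c j * c l * (μ ^ 4 / ((x j ^ 3 + μ ^ 3) * (x l ^ 3 + μ ^ 3)))) (Ioi 0) :=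
    fun j l => (integrableOn_pair4 (x j) (x l) (hx j) (hx l)).const_mul (c j * c l)
  rw [integral_finsetSum _ (fun j _ => integrable_finsetSum _ (fun l _ => hint j l))]
  simp_rw [integral_finsetSum _ (fun l _ => hint _ l), integral_const_mul]
  rw [Finset.mul_sum]
  refine Finset.sum_congr rfl fun j _ => ?_
  rw [Finset.mul_sum]
  refine Finset.sum_congr rfl fun l _ => ?_
  rw [integral_pair4 (x j) (x l) (hx j) (hx l)]
  have hq : x j ^ 2 + x j * x l + x l ^ 2 ≠ 0 := by have := hx j; have := hx l; positivity
  field_simp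

/-- **The `t^{2/3}` Loewner form is non-negative**: `0 ≤ Σⱼₗ cⱼ cₗ (xⱼ + xₗ)/(xⱼ² + xⱼxₗ + xₗ²)` for positive `xⱼ`. -/
theorem twoThirdsLoewner_nonneg {k : ℕ} (x c : Fin k → ℝ) (hx : ∀ i, 0 < x i) :
    0 ≤ ∑ j, ∑ l, c j * c l * (x j + x l) / (x j ^ 2 + x j * x l + x l ^ 2) := by
  have hI := I2_pos
  have h := twoThirdsLoewner_form_eq_integral x c hx
  have hnn : 0 ≤ ∫ μ in Ioi (0:ℝ), μ ^ 4 * (∑ j, c j / (x j ^ 3 + μ ^ 3)) ^ 2 :=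
    setIntegral_nonneg measurableSet_Ioi fun μ hμ => by
      have : (0:ℝ) < μ := hμ
      positivity
  rw [← h] at hnn
  exact nonneg_of_mul_nonneg_right hnn hI

/-- **The `t^{2/3}` Loewner kernel is positive definite**: for pairwise distinct positive `xⱼ` and `c ≠ 0`,
`0 < Σⱼ Σₗ cⱼ cₗ (xⱼ + xₗ)/(xⱼ² + xⱼxₗ + xₗ²)` (the Loewner matrix of `t ↦ t^{2/3}` at the points `xⱼ³`; Löwner–Heinz). -/
theorem twoThirdsLoewner_posDef (k : ℕ) (x c : Fin k → ℝ) (hx : ∀ i, 0 < x i) (hinj : Function.Injective x) (hc : c ≠ 0) :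
    0 < ∑ j, ∑ l, c j * c l * (x j + x l) / (x j ^ 2 + x j * x l + x l ^ 2) := by
  have hI := I2_pos
  have h := twoThirdsLoewner_form_eq_integral x c hx
  obtain ⟨μ₀, hμ₀, hR⟩ := exists_sum_div_ne_zero x c hx hinj hc
  let g : ℝ → ℝ := fun μ => μ ^ 4 * (∑ j, c j / (x j ^ 3 + μ ^ 3)) ^ 2
  have hgint : IntegrableOn g (Ioi 0) := by
    have hpt : ∀ μ ∈ Ioi (0:ℝ), g μ = ∑ j, ∑ l, c j * c l * (μ ^ 4 / ((x j ^ 3 + μ ^ 3) * (x l ^ 3 + μ ^ 3))) := by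
      intro μ hμ
      have hμ' : 0 < μ := hμ
      simp only [g]
      rw [pow_two, Finset.sum_mul_sum, Finset.mul_sum]
      refine Finset.sum_congr rfl fun j _ => ?_
      rw [Finset.mul_sum]
      refine Finset.sum_congr rfl fun l _ => ?_
      have h1 : x j ^ 3 + μ ^ 3 ≠ 0 := by have := hx j; positivity
      have h2 : x l ^ 3 + μ ^ 3 ≠ 0 := by have := hx l; positivity
      field_simp
    refine IntegrableOn.congr_fun ?_ (fun μ hμ => (hpt μ hμ).symm) measurableSet_Ioi
    exact integrable_finsetSum _ fun j _ => integrable_finsetSum _ fun l _ =>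
      (integrableOn_pair4 (x j) (x l) (hx j) (hx l)).const_mul (c j * c l)
  have hgpos : 0 < ∫ μ in Ioi (0:ℝ), g μ := by
    rw [setIntegral_pos_iff_support_of_nonneg_ae ?_ hgint]
    · have hg0 : 0 < g μ₀ := by
        simp only [g]
        have : 0 < (∑ j, c j / (x j ^ 3 + μ₀ ^ 3)) ^ 2 := by positivity
        positivity
      have hcontOn : ContinuousOn g (Ioi 0) := by
        refine ContinuousOn.mul (by fun_prop) (ContinuousOn.pow ?_ 2)
        refine continuousOn_finsetSum _ fun j _ => ?_
        refine ContinuousOn.div continuousOn_const (by fun_prop) ?_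
        intro μ hμ
        have : (0:ℝ) < μ := hμ
        have := hx j
        positivity
      have hcont : ContinuousAt g μ₀ := hcontOn.continuousAt (Ioi_mem_nhds hμ₀)
      have hev : ∀ᶠ μ in 𝓝 μ₀, 0 < g μ := hcont.eventually (lt_mem_nhds hg0)
      obtain ⟨ε, hε, hball⟩ := Metric.eventually_nhds_iff.mp hev
      let δ : ℝ := min ε μ₀ / 2
      have hδ : 0 < δ := by positivity
      have hsub : Ioo (μ₀ - δ) (μ₀ + δ) ⊆ Function.support g ∩ Ioi 0 := by
        intro μ hμ
        rw [Set.mem_Ioo] at hμ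
        have hδε : δ < ε := by
          have : min ε μ₀ ≤ ε := min_le_left _ _
          simp only [δ]; linarith
        have hδμ : δ < μ₀ := by
          have : min ε μ₀ ≤ μ₀ := min_le_right _ _
          simp only [δ]; linarith
        refine ⟨?_, ?_⟩
        · have : 0 < g μ := hball (by rw [Real.dist_eq, abs_lt]; constructor <;> linarith)
          exact ne_of_gt this
        · show 0 < μ
          linarith
      calc (0 : ENNReal) < volume (Ioo (μ₀ - δ) (μ₀ + δ)) := by
            rw [Real.volume_Ioo]; exact ENNReal.ofReal_pos.mpr (by linarith)
        _ ≤ volume (Function.support g ∩ Ioi 0) := measure_mono hsub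
    · rw [EventuallyLE, ae_restrict_iff' measurableSet_Ioi]
      exact Filter.Eventually.of_forall fun μ hμ => by
        have : (0:ℝ) < μ := hμ
        simp only [Pi.zero_apply, g]
        positivity
  have hprod : 0 < (∫ s in Ioi (0:ℝ), s / (1 + s ^ 3)) * ∑ j, ∑ l, c j * c l * (x j + x l) / (x j ^ 2 + x j * x l + x l ^ 2) := by
    rw [h]; exact hgpos
  exact pos_of_mul_pos_right hprod hI.le

/-! ## 2. The two-class law at ratio 3 : 2, unconditional -/

/-- **THE TWO-CLASS LAW at ratio 3 : 2.**  `A ∈ Sym(n)`, `C ∈ Sym(m)`, any real `B`, `1 ≤ a`: a finite set of positive `x`, each carrying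
a non-zero kernel vector of `[[A + x^{2a}·1, B], [Bᵀ, C − x^{3a}·1]]`, has at most `n + 2m` elements. -/
theorem card_posZeros_le_blocks_threeHalves (A : Matrix (Fin n) (Fin n) ℝ) (hA : A.IsSymm) (C : Matrix (Fin m) (Fin m) ℝ)
    (hC : C.IsSymm) (B : Matrix (Fin n) (Fin m) ℝ) (a : ℕ) (ha : 1 ≤ a) (S : Finset ℝ)
    (hS : ∀ x ∈ S, 0 < x ∧ ∃ w : Fin n → ℝ, ∃ q : Fin m → ℝ, (w ≠ 0 ∨ q ≠ 0) ∧
      (A + (x ^ (2 * a)) • (1 : Matrix (Fin n) (Fin n) ℝ)) *ᵥ w + B *ᵥ q = 0 ∧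
      Bᵀ *ᵥ w + (C - (x ^ (3 * a)) • (1 : Matrix (Fin m) (Fin m) ℝ)) *ᵥ q = 0) :
    S.card ≤ n + 2 * m :=
  card_posZeros_le_blocks_threeHalves_of_loewner twoThirdsLoewner_posDef A hA C hC B a ha S hS

/-- **THE TWO-CLASS LAW at ratio 3 : 2, determinant currency.**  For `A ∈ Sym(n)`, `C ∈ Sym(m)`, any real `B`, `1 ≤ a`: the
determinant of the block lacunary pencil `[[A + X^{2a}·1, B], [Bᵀ, C − X^{3a}·1]]` has at most `n + 2m` distinct positive real
roots. -/
theorem card_posRoots_det_blockPencil_le_threeHalves (A : Matrix (Fin n) (Fin n) ℝ) (hA : A.IsSymm)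
    (C : Matrix (Fin m) (Fin m) ℝ) (hC : C.IsSymm) (B : Matrix (Fin n) (Fin m) ℝ) (a : ℕ) (ha : 1 ≤ a) :
    ((Matrix.det (Matrix.fromBlocks (A.map Polynomial.C + ((Polynomial.X : Polynomial ℝ) ^ (2 * a)) • 1) (B.map Polynomial.C)
          (Bᵀ.map Polynomial.C)
          (C.map Polynomial.C - ((Polynomial.X : Polynomial ℝ) ^ (3 * a)) • 1))).roots.toFinset.filter
        (fun x => 0 < x)).card ≤ n + 2 * m :=
  card_posRoots_det_blockPencil_le_threeHalves_of_loewner twoThirdsLoewner_posDef A hA C hC B a ha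

end MixedGauge

end Summit.ValiantsHypothesis.ValiantsHypothesis.Theorems.KPlusLogSqLaw
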